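import Summits.AtomisticToContinuum.BoseEinsteinCondensation.Theorems.BECInsertionCorrectorCorrectorClosureFirstCorrectorBoundModeBound
import Summits.AtomisticToContinuum.BoseEinsteinCondensation.Theorems.BECInsertionCorrectorCorrectorClosureFirstCorrectorBoundPotential
import Summits.AtomisticToContinuum.BoseEinsteinCondensation.Theorems.BECInsertionCorrectorCorrectorClosureGroundStateExistsOfFK
import Summits.AtomisticToContinuum.BoseEinsteinCondensation.Theorems.CorrectorClosure.Negative.InsertionResidueHardCoreJamming
import Literature.MathematicalPhysics.QuantumManyBody.PeriodicCondensateCoherence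
import Literature.MathematicalPhysics.QuantumManyBody.PeriodicFeynmanKacCell
import Mathlib.MeasureTheory.Integral.MeanInequalities
import HarnessLib

/-!
# Crux `CorrectorClosure` (stmt-AtomisticToContinuum-12058), line `residue-area-law` —
# registered stub `stub_firstCorrectorBound`: the `N`-uniform `H₋₁` bound of the centred impurity coupling

Supports (does not close) stmt-AtomisticToContinuum-12058, route `BECInsertionCorrector`: the
route's FirstCorrectorBounds (layer 1 of the two-layer plan) in the weighted-corrector vocabulary
of `WeightedCorrector.lean`.

**Statement.** Given `StaticResponseBound` (K1), for every bounded repulsive finite-range `v`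
there are `ρ₁ > 0`, `C₁ > 0` such that for `0 < ρ < ρ₁`, `N ≥ 1`, `L = sideLength ρ (N+1)` with
`v^per` bounded, and every continuous positive torus Feynman–Kac ground state `Θ₀` of the `N`-body
bath in that box, the CENTRED impurity coupling `W̃(X) = ∑ⱼ v^per(xⱼ - y) - N L⁻³ ∫v`
(`y = X 0`, `xⱼ = X j.succ`) has Kipnis–Varadhan norm
`hMinusOneSqW L (Θ₀ ∘ vecTail) W̃ ≤ C₁ N` for the PRODUCT weight on the `(N+1)`-torus.

**Proof.** (1) K1 ⇒ per-mode bounds `‖∑ⱼcos(p_k·xⱼ)‖²₋₁, ‖∑ⱼsin(p_k·xⱼ)‖²₋₁ ≤ C_K N/|p_k|²` for the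
bath at density `ρN/(N+1) < ρ₀` in the same box (`responseDictionary_fk`, file `…Dictionary`).
(2) Expand `v^per` in the tagged coordinate: with the real cubic partial Fourier sums
`R_K = Re S_K v^per`, `W̃ = M_K + E_K` where `M_K = ∑_{k ∈ half cube} (a_k(X')cos(p_k·y) + b_k(X')sin(p_k·y))`
is a finite tagged-mode sum with bath coefficients `a_k = 2(Re ĉ_k ∑ⱼcos + Im ĉ_k ∑ⱼ sin)`,
`b_k = 2(Re ĉ_k ∑ⱼ sin - Im ĉ_k ∑ⱼcos)` and `E_K = ∑ⱼ (v^per - R_K)(y - xⱼ)` (evenness of `v^per`,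
`ĉ₋ₖ = conj ĉ_k`, `Re ĉ₀ = L⁻³∫v`; file `…Potential`). (3) `‖M_K‖²₋₁ ≤ C_K(192κ² + C_vκ) N`
uniformly in `K` (`hMinusOneSqW_tail_modes_le`, the coefficient bound `‖a_k‖², ‖b_k‖² ≤ 8|ĉ_k|²C_KN/|p_k|²`,
and the lattice sum `∑_{k≠0}|ĉ_k|²/|k|² ≤ L⁻⁵(192κ² + C_vκ)` from `|ĉ_k| ≤ L⁻³κ`, Parseval and the
shell bound `∑_{1≤|k|∞≤K₀}|k|∞⁻² ≤ 96K₀` at `K₀ = ⌈L⌉`; here `L ≥ 1`, `L > 2R₀` by the choice of `ρ₁`;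
file `…ModeBound`). (4) For every periodic test `φ`, `2∫W̃φF² - 𝓔_F(φ,φ) = [2∫M_KφF² - 𝓔_F(φ,φ)] + 2∫E_KφF²
≤ C₁N + 2∫E_KφF²`, and `∫E_KφF² → 0` as `K → ∞` (Tonelli along the tagged particle, Cauchy–Schwarz on
the cell, `L²` convergence of the Fourier series of the bounded measurable `v^per`; section `Error`
below: `‖∫ E_K φ Θ₀(X')²‖ ≤ M_φ M_Θ² · N · |cell^N| · ‖U - Re S_K U‖_{L²(cell)} · |cell|^{1/2}`).
-/

noncomputable section

open MeasureTheory Filter Matrix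
open scoped ENNReal NNReal BigOperators Topology

namespace Summit.AtomisticToContinuum.BoseEinsteinCondensation.Theorems.CorrectorClosure.ResidueAreaLaw

open Literature.MathematicalPhysics.QuantumManyBody.BoseGas
open Summit.AtomisticToContinuum.BoseEinsteinCondensation.Theses.BECInsertionCorrector
open Summit.AtomisticToContinuum.BoseEinsteinCondensation.Theorems.CorrectorClosure.Negative
  (sideLength_succ_pos sideLength_succ_pow_three)
open Summit.AtomisticToContinuum.BoseEinsteinCondensation.Theorems.CorrectorClosure.HealingScaleKacInsertion
  (hMinusOneSqW_le_of_forall_test continuous_vecTail_config)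

section Error

variable {N : ℕ} {L : ℝ}

/-! ### The error integral along the tagged particle -/

/-- **Tonelli + translation invariance**: `∫_{cell^{N+1}} ‖g(X 0 - X'ⱼ)‖ dX = |cell^N| ∫_{cell} ‖g‖`
for measurable `Lℤ³`-periodic `g`. [folklore] -/
theorem lintegral_cellN_succ_enorm_comp_sub (hL : 0 < L) {g : Space → ℝ} (hg : Measurable g)
    (hper : ∀ (z : Space) (k : Fin 3), g (z + EuclideanSpace.single k L) = g z) (j : Fin N) :
    ∫⁻ X in cellN (N + 1) L, ‖g (X 0 - vecTail X j)‖ₑ =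
      volume (cellN N L) * ∫⁻ z in cell L, ‖g z‖ₑ := by
  have hmeas : Measurable fun X : Config (N + 1) => ‖g (X 0 - vecTail X j)‖ₑ :=
    (hg.comp ((measurable_pi_apply 0).sub (measurable_pi_apply j.succ))).enorm
  rw [setLIntegral_cellN_succ_right hmeas]
  have hinner : ∀ Y : Config N, ∫⁻ x in cell L, ‖g (vecCons x Y 0 - vecTail (vecCons x Y) j)‖ₑ =
      ∫⁻ z in cell L, ‖g z‖ₑ := by
    intro Y
    simp only [Matrix.cons_val_zero, Matrix.tail_cons, sub_eq_add_neg]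
    exact setLIntegral_cell_comp_add_of_periodic hL (H := fun z => ‖g z‖ₑ) hg.enorm
      (fun z k => by simp only [hper]) (-Y j)
  simp only [hinner]
  rw [setLIntegral_const, mul_comm]

/-- **Cauchy–Schwarz on the cell**: `∫_{cell} ‖g‖ ≤ (∫_{cell} ‖g‖²)^{1/2} |cell|^{1/2}`. [folklore] -/
theorem lintegral_cell_enorm_le_sqrt {g : Space → ℝ} (hg : Measurable g) :
    ∫⁻ z in cell L, ‖g z‖ₑ ≤
      (∫⁻ z in cell L, ‖g z‖ₑ ^ 2) ^ (1 / 2 : ℝ) * volume (cell L) ^ (1 / 2 : ℝ) := by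
  have h := ENNReal.lintegral_mul_le_Lp_mul_Lq (volume.restrict (cell L))
    Real.HolderConjugate.two_two (f := fun z => ‖g z‖ₑ) (g := fun _ => 1)
    hg.enorm.aemeasurable aemeasurable_const
  simp only [Pi.mul_apply, mul_one, lintegral_const, Measure.restrict_apply MeasurableSet.univ,
    Set.univ_inter, one_pow, one_mul, ENNReal.rpow_two] at h
  exact h

/-- **The error estimate at fixed `K`.** For a measurable `Lℤ³`-periodic real `U`, its real partial
Fourier sums `Re S_K U`, and bounded `φ`, `Θ₀`:
`‖∫_{cell^{N+1}} (∑ⱼ (U - Re S_K U)(y - xⱼ)) φ Θ₀(X')²‖ ≤ M_φ M_Θ² · N · |cell^N| · ‖U - Re S_K U‖_{L²(cell)} · |cell|^{1/2}`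
(in `ℝ≥0∞`). [folklore] -/
theorem enorm_integral_modeErr_le (hL : 0 < L) {U : Space → ℝ} (hU : Measurable U)
    (hUper : ∀ (z : Space) (k : Fin 3), U (z + EuclideanSpace.single k L) = U z) (K : ℕ)
    {Θ₀ : Config N → ℝ} {MΘ : ℝ} (hΘb : ∀ X, |Θ₀ X| ≤ MΘ)
    {φ : Config (N + 1) → ℝ} {Mφ : ℝ} (hφb : ∀ X, |φ X| ≤ Mφ) :
    ‖∫ X in cellN (N + 1) L, (∑ j : Fin N, (U (X 0 - vecTail X j) -
        (partialSum L (fun z => (U z : ℂ)) K (X 0 - vecTail X j)).re)) * φ X * Θ₀ (vecTail X) ^ 2‖ₑ ≤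
      ENNReal.ofReal Mφ * ENNReal.ofReal (MΘ ^ 2) * (N * (volume (cellN N L) *
        ((∫⁻ z in cell L, ‖U z - (partialSum L (fun z => (U z : ℂ)) K z).re‖ₑ ^ 2) ^ (1 / 2 : ℝ) *
          volume (cell L) ^ (1 / 2 : ℝ)))) := by
  set g : Space → ℝ := fun z => U z - (partialSum L (fun z => (U z : ℂ)) K z).re with hgdef
  have hg : Measurable g := hU.sub (continuous_re_partialSum L _ K).measurable
  have hgper : ∀ (z : Space) (k : Fin 3), g (z + EuclideanSpace.single k L) = g z :=
    fun z k => by simp only [hgdef, hUper, re_partialSum_periodic hL.ne']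
  set B : ℝ≥0∞ := ENNReal.ofReal Mφ * ENNReal.ofReal (MΘ ^ 2) with hB
  -- Step (a): pointwise bound of the integrand
  have hpt : ∀ X : Config (N + 1), ‖(∑ j : Fin N, g (X 0 - vecTail X j)) * φ X * Θ₀ (vecTail X) ^ 2‖ₑ ≤
      (∑ j : Fin N, ‖g (X 0 - vecTail X j)‖ₑ) * B := by
    intro X
    rw [enorm_mul, enorm_mul, mul_assoc]
    refine mul_le_mul' (enorm_sum_le _ _) (mul_le_mul' ?_ ?_)
    · rw [← Real.enorm_abs, Real.enorm_eq_ofReal (abs_nonneg _)]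
      exact ENNReal.ofReal_le_ofReal (hφb X)
    · rw [← Real.enorm_abs, Real.enorm_eq_ofReal (abs_nonneg _)]
      refine ENNReal.ofReal_le_ofReal ?_
      rw [abs_pow, ← sq_abs MΘ]
      exact pow_le_pow_left₀ (abs_nonneg _) ((hΘb _).trans (le_abs_self _)) 2
  have hmeas : ∀ j : Fin N, Measurable fun X : Config (N + 1) => ‖g (X 0 - vecTail X j)‖ₑ := fun j =>
    (hg.comp ((measurable_pi_apply 0).sub (measurable_pi_apply j.succ))).enorm
  calc ‖∫ X in cellN (N + 1) L, (∑ j : Fin N, g (X 0 - vecTail X j)) * φ X * Θ₀ (vecTail X) ^ 2‖ₑ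
      ≤ ∫⁻ X in cellN (N + 1) L, ‖(∑ j : Fin N, g (X 0 - vecTail X j)) * φ X * Θ₀ (vecTail X) ^ 2‖ₑ :=
        enorm_integral_le_lintegral_enorm _
    _ ≤ ∫⁻ X in cellN (N + 1) L, (∑ j : Fin N, ‖g (X 0 - vecTail X j)‖ₑ) * B :=
        lintegral_mono hpt
    _ = (∑ j : Fin N, ∫⁻ X in cellN (N + 1) L, ‖g (X 0 - vecTail X j)‖ₑ) * B := by
        rw [lintegral_mul_const _ (Finset.measurable_sum _ fun j _ => hmeas j),
          lintegral_finsetSum _ fun j _ => hmeas j]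
    _ = (N * (volume (cellN N L) * ∫⁻ z in cell L, ‖g z‖ₑ)) * B := by
        simp only [lintegral_cellN_succ_enorm_comp_sub hL hg hgper]
        rw [Finset.sum_const, Finset.card_univ, Fintype.card_fin, nsmul_eq_mul]
    _ ≤ (N * (volume (cellN N L) * ((∫⁻ z in cell L, ‖g z‖ₑ ^ 2) ^ (1 / 2 : ℝ) *
          volume (cell L) ^ (1 / 2 : ℝ)))) * B := by
        gcongr
        exact lintegral_cell_enorm_le_sqrt hg
    _ = _ := by rw [mul_comm]

/-- **The error of the mode expansion is negligible**: for a bounded measurable `Lℤ³`-periodic real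
`U`, bounded `φ`, `Θ₀`, and every `ε > 0` there is `K` with
`|∫_{cell^{N+1}} (∑ⱼ (U - Re S_K U)(y - xⱼ)) φ Θ₀(X')² dX| ≤ ε`. [folklore] -/
theorem exists_abs_integral_modeErr_le (hL : 0 < L) {U : Space → ℝ} (hU : Measurable U)
    (hUper : ∀ (z : Space) (k : Fin 3), U (z + EuclideanSpace.single k L) = U z)
    {C : ℝ} (hUb : ∀ z, |U z| ≤ C)
    {Θ₀ : Config N → ℝ} {MΘ : ℝ} (hΘb : ∀ X, |Θ₀ X| ≤ MΘ)
    {φ : Config (N + 1) → ℝ} {Mφ : ℝ} (hφb : ∀ X, |φ X| ≤ Mφ) {ε : ℝ} (hε : 0 < ε) :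
    ∃ K : ℕ, |∫ X in cellN (N + 1) L, (∑ j : Fin N, (U (X 0 - vecTail X j) -
        (partialSum L (fun z => (U z : ℂ)) K (X 0 - vecTail X j)).re)) * φ X * Θ₀ (vecTail X) ^ 2| ≤ ε := by
  set D : ℝ≥0∞ := ENNReal.ofReal Mφ * ENNReal.ofReal (MΘ ^ 2) * (N * (volume (cellN N L) *
    volume (cell L) ^ (1 / 2 : ℝ))) with hD
  have hDtop : D ≠ ⊤ := by
    rw [hD]
    refine ENNReal.mul_ne_top (ENNReal.mul_ne_top ENNReal.ofReal_ne_top ENNReal.ofReal_ne_top)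
      (ENNReal.mul_ne_top (ENNReal.natCast_ne_top N) (ENNReal.mul_ne_top (volume_cellN_ne_top N L)
        (ENNReal.rpow_ne_top_of_nonneg (by norm_num) ?_)))
    rw [volume_cell]; exact ENNReal.pow_ne_top ENNReal.ofReal_ne_top
  -- `D · ‖U - Re S_K U‖_{L²} → 0`
  have hη := tendsto_lintegral_sq_sub_re_partialSum hL hU hUb
  have hsqrt : Tendsto (fun K => (∫⁻ z in cell L,
      ‖U z - (partialSum L (fun z => (U z : ℂ)) K z).re‖ₑ ^ 2) ^ (1 / 2 : ℝ)) atTop (𝓝 0) := by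
    have h := (ENNReal.continuous_rpow_const (y := (1 / 2 : ℝ))).tendsto 0 |>.comp hη
    rwa [ENNReal.zero_rpow_of_pos (by norm_num : (0 : ℝ) < 1 / 2)] at h
  have hlim : Tendsto (fun K => D * (∫⁻ z in cell L,
      ‖U z - (partialSum L (fun z => (U z : ℂ)) K z).re‖ₑ ^ 2) ^ (1 / 2 : ℝ)) atTop (𝓝 0) := by
    have h := ENNReal.Tendsto.const_mul hsqrt (Or.inr hDtop)
    rwa [mul_zero] at h
  obtain ⟨K, hK⟩ := ((tendsto_order.1 hlim).2 (ENNReal.ofReal ε) (ENNReal.ofReal_pos.2 hε)).exists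
  refine ⟨K, ?_⟩
  have hbound := enorm_integral_modeErr_le (N := N) hL hU hUper K hΘb hφb
  have hle : ‖∫ X in cellN (N + 1) L, (∑ j : Fin N, (U (X 0 - vecTail X j) -
      (partialSum L (fun z => (U z : ℂ)) K (X 0 - vecTail X j)).re)) * φ X * Θ₀ (vecTail X) ^ 2‖ₑ ≤
      ENNReal.ofReal ε := by
    refine hbound.trans (le_of_eq_of_le ?_ hK.le)
    rw [hD]; ring
  rw [← Real.norm_eq_abs, ← ENNReal.ofReal_le_ofReal_iff hε.le, ← Real.enorm_eq_ofReal (norm_nonneg _),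
    enorm_norm]
  exact hle

end Error

/-! ### The registered stub -/

/-- **Registered stub `stub_firstCorrectorBound` of line `residue-area-law` — the first-corrector
bound (route FirstCorrectorBounds, layer 1 of the two-layer plan; K1 consumed by name).** Given
`StaticResponseBound`, for every bounded repulsive finite-range `v` there are `ρ₁ > 0` and `C₁ > 0`
such that for `0 < ρ < ρ₁`, `N ≥ 1`, `L = sideLength ρ (N+1)` with `v^per` bounded, and every
continuous positive torus FK ground state `Θ₀` of the `N`-body bath in that box, the CENTRED
impurity coupling `W̃(X) = ∑ⱼ v^per(xⱼ − y) − N L⁻³ ∫_{ℝ³} v` (`y = X 0` the tagged coordinate) has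
Kipnis–Varadhan norm `hMinusOneSqW L (Θ₀ ∘ vecTail) W̃ ≤ C₁ N` for the PRODUCT weight on the
`(N+1)`-torus (weight mass `L³`; per unit `y`-mass `C₁N/L³ = O(ρ)`). Proof in the module docstring:
per-mode dictionary from K1, tagged-coordinate Fourier expansion of `v^per`, orthogonality of the
tagged modes, the elementary lattice sum, and negligibility of the expansion error for every test
function. [cite: KipnisLandim1999, App. 1 §6 (variational formula for ‖·‖₋₁); GuentherEtAl2021, eq. (10)] -/
theorem stub_firstCorrectorBound (hK1 : StaticResponseBound) (v : ℝ → ℝ≥0∞)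
    (hv : IsRepulsiveFiniteRange v) (hbdd : ∃ C : ℝ≥0, ∀ r, v r ≤ C) :
    ∃ ρ₁ : ℝ, 0 < ρ₁ ∧ ∃ C₁ : ℝ, 0 < C₁ ∧ ∀ ρ : ℝ, 0 < ρ → ρ < ρ₁ → ∀ N : ℕ, 1 ≤ N →
      ∀ (L : ℝ), L = sideLength ρ (N + 1) →
      (∃ C' : ℝ≥0, ∀ x, periodizedPotential v L x ≤ C') →
      ∀ (Θ₀ : Config N → ℝ), IsPeriodicGroundStateFK v L Θ₀ → Continuous Θ₀ → (∀ X, 0 < Θ₀ X) →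
        hMinusOneSqW L (fun X : Config (N + 1) => Θ₀ (vecTail X))
            (fun X : Config (N + 1) =>
              (impurityInteraction v L (X 0) (vecTail X)).toReal -
                (N : ℝ) / L ^ 3 * (∫⁻ x : Space, v ‖x‖).toReal) ≤
          ENNReal.ofReal (C₁ * N) := by
  obtain ⟨ρK, hρK, CK, hCK, hdict⟩ := responseDictionary_fk hK1 v hv
  obtain ⟨R₀, hR₀⟩ := hv.2
  obtain ⟨Cv, hCv⟩ := hbdd
  set κ : ℝ := (∫⁻ x : Space, v ‖x‖).toReal with hκ
  have hκ0 : 0 ≤ κ := ENNReal.toReal_nonneg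
  -- thresholds: `ρ < ρ_K` (K1) and `ρ < 1/ℓ₀³`, `ℓ₀ = max 2 (2R₀ + 1)` (so that `L ≥ 1`, `L > 2R₀`)
  set ℓ₀ : ℝ := max 2 (2 * R₀ + 1) with hℓ₀
  have hℓ₀pos : 0 < ℓ₀ := lt_of_lt_of_le two_pos (le_max_left _ _)
  refine ⟨min ρK (1 / ℓ₀ ^ 3), lt_min hρK (by positivity), CK * (192 * κ ^ 2 + Cv * κ) + 1,
    by positivity, ?_⟩
  intro ρ hρ hρ₁ N hN L hLdef hC' Θ₀ hΘ hΘc _hΘp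
  have hρK' : ρ < ρK := hρ₁.trans_le (min_le_left _ _)
  have hL : 0 < L := by rw [hLdef]; exact sideLength_succ_pos hρ N
  have hN0 : (0 : ℝ) ≤ N := Nat.cast_nonneg N
  -- `ℓ₀ < L`
  have hLℓ : ℓ₀ < L := by
    have hρℓ : ρ < 1 / ℓ₀ ^ 3 := hρ₁.trans_le (min_le_right _ _)
    have h1 : ℓ₀ ^ 3 < L ^ 3 := by
      rw [hLdef, sideLength_succ_pow_three hρ N]
      calc ℓ₀ ^ 3 < 1 / ρ := by
            rw [lt_div_iff₀ hρ]
            calc ℓ₀ ^ 3 * ρ < ℓ₀ ^ 3 * (1 / ℓ₀ ^ 3) := by gcongr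
              _ = 1 := by field_simp
        _ ≤ ((N : ℝ) + 1) / ρ := by gcongr; linarith
    exact lt_of_pow_lt_pow_left₀ 3 hL.le h1
  have hL1 : 1 ≤ L := by linarith [le_max_left 2 (2 * R₀ + 1)]
  have h2R : 2 * R₀ < L := by linarith [le_max_right 2 (2 * R₀ + 1)]
  -- the UNIFORM bound of `v^per` (`L > 2R₀`: at most one image)
  have hCU : ∀ x, periodizedPotential v L x ≤ Cv := periodizedPotential_le_of_range hR₀ h2R hL hCv
  -- (1) the per-mode dictionary at this `ρ, N, L, Θ₀`
  have hd := hdict ρ hρ hρK' N hN L hLdef hC' Θ₀ hΘ hΘc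
  -- (3) the finite mode sums over the half cubes are bounded uniformly in `K`: coefficient data
  have hA : ∀ k, |‖cellFourierCoeff L (fun z => (((periodizedPotential v L z).toReal : ℝ) : ℂ)) k‖| ≤
      (L ^ 3)⁻¹ * κ := fun k => by
    rw [abs_norm, hκ, ← integral_cell_norm_toReal_periodizedPotential hL hv.1 hCU]
    exact norm_cellFourierCoeff_le hL _ k
  have hP : ∀ T : Finset (Fin 3 → ℤ),
      ∑ k ∈ T, ‖cellFourierCoeff L (fun z => (((periodizedPotential v L z).toReal : ℝ) : ℂ)) k‖ ^ 2 ≤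
        (L ^ 3)⁻¹ * (Cv * κ) := by
    intro T
    refine (sum_sq_cellFourierCoeff_le_of_bound hL
      (Complex.measurable_ofReal.comp (measurable_toReal_periodizedPotential hv.1 L))
      (norm_toReal_periodizedPotential_le hCU) T).trans ?_
    exact mul_le_mul_of_nonneg_left (integral_cell_sq_toReal_periodizedPotential_le hL hv.1 hCU)
      (by positivity)
  have hc : ∀ k, (cellFourierCoeff L (fun z => (((periodizedPotential v L z).toReal : ℝ) : ℂ)) k).re ^ 2 +
      (cellFourierCoeff L (fun z => (((periodizedPotential v L z).toReal : ℝ) : ℂ)) k).im ^ 2 =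
      ‖cellFourierCoeff L (fun z => (((periodizedPotential v L z).toReal : ℝ) : ℂ)) k‖ ^ 2 := fun k => by
    rw [Complex.sq_norm, Complex.normSq_apply]; ring
  have hA2 : ∀ k, (cellFourierCoeff L (fun z => (((periodizedPotential v L z).toReal : ℝ) : ℂ)) k).re ^ 2 +
      (cellFourierCoeff L (fun z => (((periodizedPotential v L z).toReal : ℝ) : ℂ)) k).im ^ 2 ≤
      ((L ^ 3)⁻¹ * κ) ^ 2 := fun k => by
    rw [hc k, ← sq_abs]
    exact pow_le_pow_left₀ (abs_nonneg _) (hA k) 2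
  have hP2 : ∀ T : Finset (Fin 3 → ℤ),
      ∑ k ∈ T, ((cellFourierCoeff L (fun z => (((periodizedPotential v L z).toReal : ℝ) : ℂ)) k).re ^ 2 +
        (cellFourierCoeff L (fun z => (((periodizedPotential v L z).toReal : ℝ) : ℂ)) k).im ^ 2) ≤
      (L ^ 3)⁻¹ * (Cv * κ) := fun T => by
    simp only [hc]; exact hP T
  -- (4) every term of the variational supremum
  obtain ⟨MΘ, -, hMΘ⟩ := exists_bound_of_continuous_periodic hL hΘc hΘ.periodic
  refine hMinusOneSqW_le_of_forall_test fun φ hφ => ?_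
  refine ENNReal.ofReal_le_ofReal ?_
  obtain ⟨Mφ, hMφ0, hMφ⟩ := exists_bound_of_continuous_periodic hL hφ.continuous hφ.2
  refine le_of_forall_pos_le_add fun ε hε => ?_
  obtain ⟨K, hK⟩ := exists_abs_integral_modeErr_le (N := N) hL
    (measurable_toReal_periodizedPotential hv.1 L) (toReal_periodizedPotential_periodic v L)
    (abs_toReal_periodizedPotential_le hCU) hMΘ hMφ (half_pos hε)
  -- (2)+(3) the mode sum `M_K` over the half cube: its bound, continuity, and `W̃ = M_K + E_K`
  obtain ⟨M, hMK, hMc, hdec⟩ : ∃ M : Config (N + 1) → ℝ,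
      hMinusOneSqW L (fun X : Config (N + 1) => Θ₀ (vecTail X)) M ≤
        ENNReal.ofReal (CK * (192 * κ ^ 2 + Cv * κ) * N) ∧
      Continuous M ∧
      ∀ X : Config (N + 1), (impurityInteraction v L (X 0) (vecTail X)).toReal - (N : ℝ) / L ^ 3 * κ =
        M X + ∑ j : Fin N, ((periodizedPotential v L (X 0 - vecTail X j)).toReal -
          (partialSum L (fun z => (((periodizedPotential v L z).toReal : ℝ) : ℂ)) K (X 0 - vecTail X j)).re) :=
    ⟨_, (modes_continuous_and_hMinusOneSqW_le hL1 hΘc hCK.le hd (zero_notMem_halfCube K)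
        (fun m hm => neg_notMem_halfCube hm)
        (fun k => (cellFourierCoeff L (fun z => (((periodizedPotential v L z).toReal : ℝ) : ℂ)) k).re)
        (fun k => (cellFourierCoeff L (fun z => (((periodizedPotential v L z).toReal : ℝ) : ℂ)) k).im)
        hκ0 Cv.coe_nonneg hA2 hP2).2,
      (modes_continuous_and_hMinusOneSqW_le hL1 hΘc hCK.le hd (zero_notMem_halfCube K)
        (fun m hm => neg_notMem_halfCube hm)
        (fun k => (cellFourierCoeff L (fun z => (((periodizedPotential v L z).toReal : ℝ) : ℂ)) k).re)
        (fun k => (cellFourierCoeff L (fun z => (((periodizedPotential v L z).toReal : ℝ) : ℂ)) k).im)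
        hκ0 Cv.coe_nonneg hA2 hP2).1,
      fun X => centredImpurity_eq_modes_add_err hL hv.1 hCU (sum_cube_eq_halfCube K) X⟩
  -- integrability bookkeeping for the splitting `W̃ = M_K + E_K`
  have hF : Continuous fun X : Config (N + 1) => Θ₀ (vecTail X) := hΘc.comp continuous_vecTail_config
  have hWm : Measurable fun X : Config (N + 1) =>
      ((impurityInteraction v L (X 0) (vecTail X)).toReal - (N : ℝ) / L ^ 3 * κ) * φ X *
        Θ₀ (vecTail X) ^ 2 :=
    (((measurable_toReal_impurityInteraction hv.1 L).sub measurable_const).mul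
      hφ.continuous.measurable).mul (hF.measurable.pow_const 2)
  have hWb : ∀ X : Config (N + 1),
      ‖((impurityInteraction v L (X 0) (vecTail X)).toReal - (N : ℝ) / L ^ 3 * κ) * φ X *
        Θ₀ (vecTail X) ^ 2‖ ≤ (N * Cv + (N : ℝ) / L ^ 3 * κ) * Mφ * MΘ ^ 2 := by
    intro X
    rw [Real.norm_eq_abs, abs_mul, abs_mul, abs_pow]
    have h1 := abs_centredImpurity_le (N := N) hL hCU X
    have h2 := hMφ X
    have h3 : |Θ₀ (vecTail X)| ^ 2 ≤ MΘ ^ 2 :=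
      pow_le_pow_left₀ (abs_nonneg _) ((hMΘ _).trans (le_abs_self _)) 2 |>.trans (sq_abs MΘ).le
    have h0 : 0 ≤ (N * Cv + (N : ℝ) / L ^ 3 * κ) := by positivity
    exact mul_le_mul (mul_le_mul h1 h2 (abs_nonneg _) h0) h3 (by positivity) (mul_nonneg h0 hMφ0)
  have hWint : IntegrableOn (fun X : Config (N + 1) =>
      ((impurityInteraction v L (X 0) (vecTail X)).toReal - (N : ℝ) / L ^ 3 * κ) * φ X *
        Θ₀ (vecTail X) ^ 2) (cellN (N + 1) L) volume :=
    Measure.integrableOn_of_bounded (volume_cellN_ne_top _ _) hWm.aestronglyMeasurable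
      (ae_of_all _ hWb)
  have hMint : IntegrableOn (fun X : Config (N + 1) => M X * φ X * Θ₀ (vecTail X) ^ 2)
      (cellN (N + 1) L) volume :=
    integrableOn_cellN ((hMc.mul hφ.continuous).mul (hF.pow 2)) L
  have hEeq : (fun X : Config (N + 1) => (∑ j : Fin N, ((periodizedPotential v L (X 0 - vecTail X j)).toReal -
      (partialSum L (fun z => (((periodizedPotential v L z).toReal : ℝ) : ℂ)) K (X 0 - vecTail X j)).re)) *
        φ X * Θ₀ (vecTail X) ^ 2) =
      fun X => ((impurityInteraction v L (X 0) (vecTail X)).toReal - (N : ℝ) / L ^ 3 * κ) * φ X *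
        Θ₀ (vecTail X) ^ 2 - M X * φ X * Θ₀ (vecTail X) ^ 2 := by
    funext X
    rw [hdec X]
    ring
  have hEint : IntegrableOn (fun X : Config (N + 1) => (∑ j : Fin N,
      ((periodizedPotential v L (X 0 - vecTail X j)).toReal -
        (partialSum L (fun z => (((periodizedPotential v L z).toReal : ℝ) : ℂ)) K (X 0 - vecTail X j)).re)) *
        φ X * Θ₀ (vecTail X) ^ 2) (cellN (N + 1) L) volume := by
    rw [hEeq]; exact hWint.sub hMint
  have hsplit : ∫ X in cellN (N + 1) L,
      ((impurityInteraction v L (X 0) (vecTail X)).toReal - (N : ℝ) / L ^ 3 * κ) * φ X *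
        Θ₀ (vecTail X) ^ 2 =
      (∫ X in cellN (N + 1) L, M X * φ X * Θ₀ (vecTail X) ^ 2) +
        ∫ X in cellN (N + 1) L, (∑ j : Fin N, ((periodizedPotential v L (X 0 - vecTail X j)).toReal -
          (partialSum L (fun z => (((periodizedPotential v L z).toReal : ℝ) : ℂ)) K (X 0 - vecTail X j)).re)) *
          φ X * Θ₀ (vecTail X) ^ 2 := by
    rw [← integral_add hMint hEint]
    refine integral_congr_ae (ae_of_all _ fun X => ?_)
    dsimp only
    rw [hdec X]
    ring
  -- the mode-sum term is at most `C_K (192κ² + C_vκ) N`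
  have hMK' : 2 * (∫ X in cellN (N + 1) L, M X * φ X * Θ₀ (vecTail X) ^ 2) -
      dirichletFormW L (fun X : Config (N + 1) => Θ₀ (vecTail X)) φ φ ≤
        CK * (192 * κ ^ 2 + Cv * κ) * N := by
    have h := (le_hMinusOneSqW L (fun X : Config (N + 1) => Θ₀ (vecTail X)) M hφ).trans hMK
    exact (ENNReal.ofReal_le_ofReal_iff (by positivity)).1 h
  have hE := (abs_le.1 hK).2
  show 2 * (∫ X in cellN (N + 1) L,
      ((impurityInteraction v L (X 0) (vecTail X)).toReal - (N : ℝ) / L ^ 3 * κ) * φ X *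
        Θ₀ (vecTail X) ^ 2) - dirichletFormW L (fun X : Config (N + 1) => Θ₀ (vecTail X)) φ φ ≤
    (CK * (192 * κ ^ 2 + Cv * κ) + 1) * N + ε
  rw [hsplit]
  nlinarith

end Summit.AtomisticToContinuum.BoseEinsteinCondensation.Theorems.CorrectorClosure.ResidueAreaLaw

end
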